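/-
Copyright (c) 2026 the pub-hodgecm-mathlib formalisation cell (harness21).  Prover seat hodgecm-mathlib-K2E1-p08 (g3), Track B ∕ K2-LIT
(build stream 29), h413 = `stmt-HodgeConjecture-24833`, line `K2_E1_TraceFormulaBeta`, row 13 ∕ row 22 (d); dealer K2E1-plan (g2) STANDING DEALS memo
`K2/K2E1-plan/g2/DEALS-g3.K2E1-plan-g2.md` DEAL D (c′), after K2E1-r01 (g2)'s INFO 2026-09-04T00:52:30Z.  2026-09-04.
-/
import Summits.HodgeConjecture.HodgeConjecture.Theorems.K2E1PinnedEqOfLaws     -- ★ p856220 (K2E1-p08 g2): `mSum_eq_finsum_of_cut`, `pinnedEq1383Hyp_of_laws` (15-law form); brings ★ `TwistedComparisonData`, ★ `PinnedEq1383Hyp`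
import HarnessLib

/-!
# h413 ∕ Track B «K2-LIT», line `K2_E1_TraceFormulaBeta`, row 13 ∕ row 22 (d): `PinnedEq1383Hyp` ⟸ THE FIVE COEFFICIENT LAWS of a twisted-comparison datum extending the pinned
# functionals (helper `K2E1PinnedEqOfCoeffLaws` = DEAL D (c′), the 5-hypothesis twin of ★ p856220 `K2E1PinnedEqOfLaws.pinnedEq1383Hyp_of_laws`)

Cell `pub/hodgecm-mathlib`, crux H413 = `stmt-HodgeConjecture-24833`, route `HCCMUnconditional`; chair K2-lead (g0), dealer K2E1-plan (g2) (STANDING DEALS memo, DEAL D;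
division of record 2026-09-04T01:03:26Z).  THEOREMS ONLY (no `def`, no posited structure, no named-fact hypothesis, no `sorry`); lane `--kind proof --supports
stmt-HodgeConjecture-24833 --as helper`; purely additive (★ p856220 untouched, imported).

WHY.  ★ p856220 `pinnedEq1383Hyp_of_laws` reads (d) of ★ `Pinned1383Letter` (★ p855340 `PinnedEq1383Hyp L v m Match trTw trG trH`: «`Tr(I_{ρ̃′}(φ̃)I(ε)) = 2 Σ_i m(π_i) Tr π_i(φ ⊗ f^v)
− Tr ρ(f^H ⊗ (f^v)^H)` on matched pairs») off ★ `TwistedComparisonData.eq1383_of_laws`, whose hypothesis `𝔨.Laws` bundles ALL FIFTEEN printed relations of Rogawski's Ch. 13–14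
comparison — but the printed deduction of (13.8.3) uses only FIVE of them: Thm 10.3.1's main equality on matching tensors (`MainEquality`, `MatchTensor`), the germ expansion Props.
13.5.1 + 13.6.1 + 13.6.2 (`GermExpansion`), «separating by Hecke eigenvalues» §13.7 (`Separation`), and the endoscopic coefficient law Prop. 13.6.2 (3) + Lemma 13.6.3 (b)(c)
(`CoeffEndoscopic`) — exactly the inputs of ★ `coeff_eq_zero_of_laws` plus the one coefficient identity (K2E1-r01 (g2) INFO 2026-09-04T00:52:30Z: the other ten are the
§13.2∕13.3∕14.6 PACKET laws — Thm 13.3.5, Prop 14.6.2, Thm 14.6.5, … — which no consumer of rows 13∕16 should have to supply).  This file states the sharper reading: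
**`pinnedEq1383Hyp_of_coeffLaws (h0 : 𝔨.MainEquality) (hT : 𝔨.MatchTensor) (hE : 𝔨.GermExpansion) (hS : 𝔨.Separation) (hC : 𝔨.CoeffEndoscopic) … : PinnedEq1383Hyp L v m Match trTw trG trH`**,
so the (13γ) socket is «the 5 coefficient laws of a datum extending the pinned functionals», not «all of Ch. 13–14»; ★ p856220's theorem is the case where the five laws are projected out of `𝔨.Laws`.

CONTENTS.  §1 `eq1383_of_coeffLaws` ((13.8.3) on `S`-parts from the five laws; proof = ★ `eq1383_of_laws` verbatim).  §2 `pinnedEq1383Hyp_of_coeffLaws` (proof = ★ p856220 §2 verbatim over §1).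

HONEST LABEL.  Count-neutral helper; closes no socket by itself; HC_CM is proved only modulo the 7 printed citations (2 remaining named inputs: hLiu418 =
`stmt-HodgeConjecture-24832`, h413 = `stmt-HodgeConjecture-24833`) until rung 0 closes.

## References
* [Rogawski1990] J. Rogawski, *Automorphic Representations of Unitary Groups in Three Variables* (1990), §13.8 display (13.8.3) p. 218; Prop. 13.6.2 (3) p. 210; Lemma 13.6.3 p. 211;
  Prop. 13.7.1 p. 213; §13.10 (13.10.1) p. 230.
* [Langlands1980] R. P. Langlands, *Base change for GL(2)* (1980), pp. 208–211 (separation by Hecke eigenvalues).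
-/

set_option autoImplicit false
set_option linter.dupNamespace false  -- the mandated namespace repeats the summit's segment (`HodgeConjecture.HodgeConjecture`)

noncomputable section

open scoped BigOperators
open NumberField IsDedekindDomain
open Literature.NumberTheory.Rogawski1990 Literature.NumberTheory.Automorphic
open Summit.HodgeConjecture.HodgeConjecture.Cruxes.H413.K2E1TraceFormulaBeta (Pl HLoc)
open Summit.HodgeConjecture.HodgeConjecture.Cruxes.H413.K2E1St1383LetterOfPinned (PinnedEq1383Hyp)
open Summit.HodgeConjecture.HodgeConjecture.Cruxes.H413.K2E1PinnedEqOfLaws (mSum_eq_finsum_of_cut)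

namespace Summit.HodgeConjecture.HodgeConjecture.Cruxes.H413.K2E1PinnedEqOfCoeffLaws

/-! ## §1 (13.8.3) on `S`-parts from the five coefficient laws -/

section Coeff

variable {TGt TG TH : Type} (𝔨 : TwistedComparisonData TGt TG TH)

/-- **(13.8.3) FROM THE FIVE COEFFICIENT LAWS**: for `ρ ∈ Π(H)` not of the form `ρ(θ)` and matching `S`-data, «`Tr(I_{ρ̃′}(φ)I_{ρ̃′}(ε)) = 2Σ m(π)Tr(π(f)) − Tr(ρ(f^H))`, the sum over the
discrete `π` on `G` with `ψ_G(t(π)) = t`» — from `MainEquality`, `MatchTensor`, `GermExpansion`, `Separation` (★ `coeff_eq_zero_of_laws`: every germ coefficient vanishes, Prop 13.7.1) and the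
endoscopic coefficient law `CoeffEndoscopic` at the germ `t(I_{ρ̃′})` (Prop 13.6.2 (3), Lemma 13.6.3 (b)(c)).  ★ `TwistedComparisonData.eq1383_of_laws` is this theorem with the five laws
projected out of `𝔨.Laws`. [cite: Rogawski1990, §13.8 display (13.8.3) p. 218; Prop. 13.7.1 p. 213; Prop. 13.6.2 (3) p. 210] [cite: Langlands1980, pp. 208–211] -/
theorem eq1383_of_coeffLaws (h0 : 𝔨.MainEquality) (hT : 𝔨.MatchTensor) (hE : 𝔨.GermExpansion) (hS : 𝔨.Separation) (hC : 𝔨.CoeffEndoscopic)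
    (ρ : 𝔨.𝔊.PacketH) (hρ : ¬ 𝔨.𝔊.IsTheta ρ) {φS : 𝔨.TGtS} {fS : 𝔨.TGS} {fHS φHS : 𝔨.THS} (hm : 𝔨.MatchS φS fS fHS φHS) :
    𝔨.trIS ρ φS = 2 * 𝔨.mSum (𝔨.germI ρ) fS - 𝔨.trHS ρ fHS := by
  have hz := 𝔨.coeff_eq_zero_of_laws h0 hT hE hS hm (𝔨.germI ρ)
  rw [(hC ρ hρ φS fS fHS φHS hm).2] at hz
  linear_combination (2 : ℂ) * hz

end Coeff

/-! ## §2 (d) `PinnedEq1383Hyp` from the five coefficient laws of any comparison datum extending the pinned functionals -/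

section Pinned

variable (L : Type) [Field L] [NumberField L] [IsCMField L] (v : Pl L)
  {TGt TG TH : Type} (𝔨 : TwistedComparisonData TGt TG TH)

/-- **(13.8.3) PINNED ⟸ THE FIVE COEFFICIENT LAWS OF ANY COMPARISON DATUM EXTENDING THE PINNED FUNCTIONALS** (DEAL D (c′); the 5-hypothesis twin of ★ p856220
`pinnedEq1383Hyp_of_laws`).  Let `𝔨` be a twisted-comparison datum (★ `TwistedComparisonData`) satisfying Thm 10.3.1's main equality (`h0`), matching ⊗ unramified units (`hT`), the
germ expansion Props. 13.5.1 + 13.6.1 + 13.6.2 (`hE`), separation by Hecke eigenvalues (`hS`) and the endoscopic coefficient law (`hC`) — NOTHING about the global packets —; `ρ` a discrete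
L-packet of `H` not of the form `ρ(θ)`; let the local test functions at `v` embed into `𝔨`'s `S`-carriers (`eT`, `eG`, `eH`, `eφH`) so that matched pairs (`Match f^H φ`) are
`MatchS`-matched, let the e.v.p. class of `t(I_{ρ̃′})` be the finite injective cut `r : ι → 𝔊.Rep` with multiplicities `m`, and let `𝔨`'s `S`-traces on the cut, on `ρ` and on `I_{ρ̃′}` be
the functionals `trG`, `trH`, `trTw` on matched pairs.  THEN ★ `PinnedEq1383Hyp L v m Match trTw trG trH`: «`Tr(I_{ρ̃′}(φ̃)I(ε)) = 2 Σ_i m(π_i) Tr π_i(φ ⊗ f^v) − Tr ρ(f^H ⊗ (f^v)^H)`» on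
every matched pair — §1 read at `S = {v}` through ★ p856220 `mSum_eq_finsum_of_cut`. [cite: Rogawski1990, §13.8 display (13.8.3) p. 218; Prop. 13.7.1 p. 213] [cite: Langlands1980, pp. 208–211] -/
theorem pinnedEq1383Hyp_of_coeffLaws (h0 : 𝔨.MainEquality) (hT : 𝔨.MatchTensor) (hE : 𝔨.GermExpansion) (hS : 𝔨.Separation) (hC : 𝔨.CoeffEndoscopic)
    (ρ : 𝔨.𝔊.PacketH) (hρ : ¬ 𝔨.𝔊.IsTheta ρ)
    {ι : Type} [Finite ι] (r : ι → 𝔨.𝔊.Rep) (hr : Function.Injective r) (hcut : ∀ π, 𝔨.germRep π = 𝔨.germI ρ ↔ π ∈ Set.range r)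
    (m : ι → ℕ) (hm : ∀ i, 𝔨.𝔊.m (r i) = m i)
    (Match : (HLoc L v → ℂ) → (Gqs L v → ℂ) → Prop) (trTw : (Gqs L v → ℂ) → ℂ) (trG : ι → (Gqs L v → ℂ) → ℂ) (trH : (HLoc L v → ℂ) → ℂ)
    (eT : (Gqs L v → ℂ) → 𝔨.TGtS) (eG : (Gqs L v → ℂ) → 𝔨.TGS) (eH eφH : (HLoc L v → ℂ) → (Gqs L v → ℂ) → 𝔨.THS)
    (hMatch : ∀ fH φ, Match fH φ → 𝔨.MatchS (eT φ) (eG φ) (eH fH φ) (eφH fH φ))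
    (htrTw : ∀ fH φ, Match fH φ → 𝔨.trIS ρ (eT φ) = trTw φ)
    (htrG : ∀ i fH φ, Match fH φ → 𝔨.trS (r i) (eG φ) = trG i φ)
    (htrH : ∀ fH φ, Match fH φ → 𝔨.trHS ρ (eH fH φ) = trH fH) :
    PinnedEq1383Hyp L v m Match trTw trG trH := by
  intro fH φ hM
  have h := eq1383_of_coeffLaws 𝔨 h0 hT hE hS hC ρ hρ (hMatch fH φ hM)
  rw [mSum_eq_finsum_of_cut 𝔨 (𝔨.germI ρ) (eG φ) r hr hcut, htrTw fH φ hM, htrH fH φ hM] at h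
  rw [h, finsum_congr fun i => by rw [hm i, htrG i fH φ hM]]

end Pinned

end Summit.HodgeConjecture.HodgeConjecture.Cruxes.H413.K2E1PinnedEqOfCoeffLaws

end
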